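import Summits.QuantumFields.YangMills.Theorems.BalabanUVNodesK2CornerRoadRowsV

/-!
# Apply check (crux workfile, NOT a Theorems file): by-name interoperability of `…Theorems.BalabanUVNodesK2CornerRoadRowsV` (PORT-1 g4) with DEF-1's `…K1R9VersionSlotDefs` (p624736),
# dag-n13-w1's `K1R9VersionSlotOfAEAtRecord` junction shape, and the record-keyed concluders p613914 ∕ p622247

(B1) K1⁹ BY NAME from the ceiling-keyed mass-band producer (type ascription to the route decl); (B2) ONE pair of slot texts pays BOTH the slot programme and DEF-1's record programme
`RowsContAll` (hence the aside K2⁷ by `endpointGivenBR13SepCoPH_of_rowsContAll`); (B3) the suppliers' honest currency: (B)-free U3-lite + anchored positive drift + a witness carrying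
«∃ v, (B)ⱽ» (dag-n13-w1's conclusion shape) ⟹ K1⁹; (B4) K1⁹ so obtained re-displays through DEF-1's `stabilityBRunRowsAtRecordR13SepCoPHV_iff_existsSlot`.  0 sorry.  Hypothesis shapes only;
nothing of Bałaban asserted; K1⁹ NOT proved; YM mass gap NOT proved.
-/

noncomputable section

open scoped Matrix.Norms.L2Operator

namespace Summit.QuantumFields.YangMills.Cruxes.EndpointGivenBR13SepCoPH.Port7CornerRoadRowsVApply

open Literature.MathematicalPhysics.QuantumFieldTheory.Balaban1983to89
open Literature.MathematicalPhysics.QuantumFieldTheory.Balaban1983to89.FlowStep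
open Literature.MathematicalPhysics.QuantumFieldTheory.Balaban1983to89.DagBinding
open Literature.MathematicalPhysics.QuantumFieldTheory.Balaban1983to89.T4Continuum (T4Family)
open Literature.MathematicalPhysics.QuantumFieldTheory.Balaban1983to89.T4CouplingMatching (HistLipschitz)
open Literature.MathematicalPhysics.QuantumFieldTheory.Balaban1983to89.Beta.Drift (OneLoopDrift)
open Summit.QuantumFields.YangMills.Theorems.BalabanUVNodesK2NamedJetsRemAt (ScaleAnchor)
open Summit.QuantumFields.YangMills.Theorems.BalabanUVNodesK2V6Defs (Window13)
open Summit.QuantumFields.YangMills.Theorems.K1V6Defs (RecordS Inhabited13 Window)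
open Summit.QuantumFields.YangMills.Theorems.BalabanUVNodesK1R8RowsDefs (RunRowsCont13 RowsContAll endpointGivenBR13SepCoPH_of_rowsContAll)
open Summit.QuantumFields.YangMills.Theorems.BalabanUVNodesK1R9VersionSlotDefs (stabilityBRunRowsAtRecordR13SepCoPHV_iff_existsSlot)
open Summit.QuantumFields.YangMills.Theses.BalabanUVNodes (EndpointGivenBR13SepCoPH StabilityBRunRowsAtRecordR13SepCoPHV)
open Summit.QuantumFields.YangMills.Theorems.BalabanUVNodesK2CornerRoadRowsV

/-- (B1) K1⁹ BY NAME, N17-free and match-free: the ceiling-keyed mass-band producer's conclusion IS the route decl `…Theses.BalabanUVNodes.StabilityBRunRowsAtRecordR13SepCoPHV`. -/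
example
    (hprod : ∀ F : T4Family, Inhabited13 F →
      ∃ (θ : Node00.Stage13HParams F 2) (h : θ.Provisos₁₃SepCoPH F 2), (θ.ZhUnity F 2 ∧ θ.SlotsNondegenerate₁₃ F 2) ∧ θ.Admissible F 2 ∧
        (∀ c : ℝ, ∃ w : WorldP, c ≤ w.βup ∧ RecordS F θ h w ∧ ∀ P : B12.RunParams, Nodes (leavesP w P)) ∧
        (∃ (Λ : ℕ → ℕ → ℝ) (M : ℝ), HistLipschitz Λ θ.γ (Node00.datumOfRecord₁₃SepCoPH F 2 θ h).βfun ∧ ∀ k, ∑ i : Fin (k + 1), |Λ k i| ≤ M) ∧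
        ∃ (b : ℕ → ℝ) (s A : ℝ), ScaleAnchor (Node00.datumOfRecord₁₃SepCoPH F 2 θ h).βfun b ∧ 0 < s ∧ OneLoopDrift s A b) :
    Summit.QuantumFields.YangMills.Theses.BalabanUVNodes.StabilityBRunRowsAtRecordR13SepCoPHV :=
  stabilityBRunRowsAtRecordR13SepCoPHV_of_ceilingKeyedRung1WithMassBandCornerLetters hprod

/-- (B2) ONE pair of SLOT texts (U3ᴷ-liteⱽ, 2ᶜᴰⱽ) pays the slot programme AND DEF-1's record programme `RowsContAll` — hence still the aside K2⁷ `EndpointGivenBR13SepCoPH` (stmt-QuantumFields-20543). -/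
example
    (hLite : ∀ (F : T4Family) (θ : Node00.Stage13HParams F 2) (hP : θ.Provisos₁₃SepCoPH F 2) (v : Node00.Revision₁₃ F 2 θ hP),
      (θ.ZhUnity F 2 ∧ θ.SlotsNondegenerate₁₃ F 2) → θ.Admissible F 2 →
      B16.EndStatementBPrinted (Node00.datumOfRecord₁₃SepCoPHV F 2 θ hP v).C → Window (Node00.datumOfRecord₁₃SepCoPHV F 2 θ hP v) →
      ∃ (Λ : ℕ → ℕ → ℝ) (M : ℝ), HistLipschitz Λ θ.γ (Node00.datumOfRecord₁₃SepCoPHV F 2 θ hP v).βfun ∧ ∀ k, ∑ i : Fin (k + 1), |Λ k i| ≤ M)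
    (hCD : ∀ (F : T4Family) (θ : Node00.Stage13HParams F 2) (hP : θ.Provisos₁₃SepCoPH F 2) (v : Node00.Revision₁₃ F 2 θ hP),
      (θ.ZhUnity F 2 ∧ θ.SlotsNondegenerate₁₃ F 2) → θ.Admissible F 2 →
      B16.EndStatementBPrinted (Node00.datumOfRecord₁₃SepCoPHV F 2 θ hP v).C → Window (Node00.datumOfRecord₁₃SepCoPHV F 2 θ hP v) →
      ∃ (b : ℕ → ℝ) (s A : ℝ), ScaleAnchor (Node00.datumOfRecord₁₃SepCoPHV F 2 θ hP v).βfun b ∧ 0 < s ∧ OneLoopDrift s A b) :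
    (∀ (F : T4Family) (θ : Node00.Stage13HParams F 2) (hP : θ.Provisos₁₃SepCoPH F 2) (v : Node00.Revision₁₃ F 2 θ hP),
      (θ.ZhUnity F 2 ∧ θ.SlotsNondegenerate₁₃ F 2) → θ.Admissible F 2 →
      B16.EndStatementBPrinted (Node00.datumOfRecord₁₃SepCoPHV F 2 θ hP v).C → Window (Node00.datumOfRecord₁₃SepCoPHV F 2 θ hP v) → RunRowsCont13 F θ) ∧
    RowsContAll ∧ EndpointGivenBR13SepCoPH :=
  ⟨rowsContAllV_of_u3LiteKV_cornerDriftPosKV hLite hCD, rowsContAll_of_u3LiteKV_cornerDriftPosKV hLite hCD,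
    endpointGivenBR13SepCoPH_of_rowsContAll (rowsContAll_of_u3LiteKV_cornerDriftPosKV hLite hCD)⟩

/-- (B3)+(B4) the suppliers' honest currency — (B)-free letters keyed on admissibility + `Window13`, and a witness displayed with «∃ v, (B)ⱽ» inside (dag-n13-w1's junction shape) ⟹ K1⁹,
which then re-displays through DEF-1's `…_iff_existsSlot` (K1⁸'s display with ONLY (B) at the slot). -/
example
    (h1E : ∀ F : T4Family, Inhabited13 F →
      ∃ (θ : Node00.Stage13HParams F 2) (h : θ.Provisos₁₃SepCoPH F 2), (θ.ZhUnity F 2 ∧ θ.SlotsNondegenerate₁₃ F 2) ∧ θ.Admissible F 2 ∧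
        (∃ v : Node00.Revision₁₃ F 2 θ h, B16.EndStatementBPrinted (Node00.datumOfRecord₁₃SepCoPHV F 2 θ h v).C) ∧ Window (Node00.datumOfRecord₁₃SepCoPH F 2 θ h))
    (hLite : ∀ (F : T4Family) (θ : Node00.Stage13HParams F 2) (hP : θ.Provisos₁₃SepCoPH F 2), (θ.ZhUnity F 2 ∧ θ.SlotsNondegenerate₁₃ F 2) → θ.Admissible F 2 → Window13 F θ hP →
      ∃ (Λ : ℕ → ℕ → ℝ) (M : ℝ), HistLipschitz Λ θ.γ (Node00.datumOfRecord₁₃SepCoPH F 2 θ hP).βfun ∧ ∀ k, ∑ i : Fin (k + 1), |Λ k i| ≤ M)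
    (hCD : ∀ (F : T4Family) (θ : Node00.Stage13HParams F 2) (hP : θ.Provisos₁₃SepCoPH F 2), (θ.ZhUnity F 2 ∧ θ.SlotsNondegenerate₁₃ F 2) → θ.Admissible F 2 → Window13 F θ hP →
      ∃ (b : ℕ → ℝ) (s A : ℝ), ScaleAnchor (Node00.datumOfRecord₁₃SepCoPH F 2 θ hP).βfun b ∧ 0 < s ∧ OneLoopDrift s A b) :
    ∀ F : T4Family, Inhabited13 F → ∃ (θ : Node00.Stage13HParams F 2) (h : θ.Provisos₁₃SepCoPH F 2),
      (θ.ZhUnity F 2 ∧ θ.SlotsNondegenerate₁₃ F 2) ∧ θ.Admissible F 2 ∧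
      (∃ v : Node00.Revision₁₃ F 2 θ h, B16.EndStatementBPrinted (Node00.datumOfRecord₁₃SepCoPHV F 2 θ h v).C) ∧
      Window (Node00.datumOfRecord₁₃SepCoPH F 2 θ h) ∧ RunRowsCont13 F θ :=
  stabilityBRunRowsAtRecordR13SepCoPHV_iff_existsSlot.mp (stabilityBRunRowsAtRecordR13SepCoPHV_of_k17ExistsSlot_bFree_u3Lite_cornerDriftPos h1E hLite hCD)

end Summit.QuantumFields.YangMills.Cruxes.EndpointGivenBR13SepCoPH.Port7CornerRoadRowsVApply

end
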